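import Mathlib
import Summits.ValiantsHypothesis.ValiantsHypothesis.Theorems.KPlusLogSqLawWeakLiftingTowerGraftNearField

/-!
# Tower graft line — T1 IN ROOT-SUM LANGUAGE (the one-call form of the sharp interface for a T2-pricer)

Mechanism file for the line `Cruxes/WeakLifting/Lines/tower_graft.lean` (crux `WeakLifting` = stmt-ValiantsHypothesis-19561, T1 «log-slope
localisation»); packaging of `…TowerGraftClusterDiscs.lean` (`card_posRoots_add_X_pow_mul_le_of_rouche_discs`, `rouche_ineq_of_rootSum_norm_lt`)
and `…TowerGraftNearField.lean` (`exists_root_near_of_residual_zero_of_farField`).  NO stub is claimed.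

THE THEOREM (`card_posRoots_add_X_pow_mul_le_of_rootSum_discs`).  `A, E ∈ ℝ[X]` non-zero, `D > 0`, `Z` = the complex roots of `A` and of `E`
(two multisets).  Suppose a finite disc system `B(ctr i, rad i)` and a scale function `δ : ℝ → ℝ` are given with
(FIELD ON CIRCLES) every circle avoids `Z` and carries `‖Σ_{roots A} τ/(τ − z) − Σ_{roots E} τ/(τ − z)‖ < D`;
(FAR FIELD ON THE AXIS) at every `t > 0` off the roots, `Σ_{z ∈ Z, ‖t − z‖ > δ(t)·t} ‖t/(t − z)‖ ≤ D/2`;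
(COVERAGE) every `t > 0` and every root `z` with `‖t − z‖ ≤ δ(t)·t` have `t` inside some disc.
Then `Z₊(A + X^D·E) ≤ Σᵢ #{distinct roots of A·E in disc i} + Z₊(A) + 3·Z₊(E) + 1`.
Everything the consumer supplies is a statement about the ROOT-SUM FIELD of the two digits near the positive axis — the T2 object.
HONEST FRAMING: packaging; nothing on S4/S4b/S5, TowerB, `WeakLifting`, B, 18050 or `VP ≠ VNP`.  Def-free.
Seat: prover val-sym-lift-p1 g20, `--supports stmt-ValiantsHypothesis-19561`.
-/

-- `Summit.ValiantsHypothesis.ValiantsHypothesis.…` repeats a component by the D-0017 layout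
-- (single-conjunct summit), which the `dupNamespace` linter flags; the name is mandated.
set_option linter.dupNamespace false

namespace Summit.ValiantsHypothesis.ValiantsHypothesis.Theorems.KPlusLogSqLaw.TowerGraft

open Polynomial Complex
open scoped BigOperators Polynomial Real

section RootSumDiscs

/-- **T1 IN ROOT-SUM LANGUAGE.**  See the module docstring. [this work] -/
theorem card_posRoots_add_X_pow_mul_le_of_rootSum_discs (A E : ℝ[X]) {D : ℕ} (hD : 0 < D) (hA : A ≠ 0) (hE : E ≠ 0)
    {ι : Type*} (I : Finset ι) (ctr : ι → ℂ) (rad : ι → ℝ) (hrad : ∀ i ∈ I, 0 < rad i) (δ : ℝ → ℝ)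
    (hfield : ∀ i ∈ I, ∀ τ ∈ Metric.sphere (ctr i) (rad i),
      (A.map Complex.ofRealHom).eval τ ≠ 0 ∧ (E.map Complex.ofRealHom).eval τ ≠ 0 ∧
      ‖((A.map Complex.ofRealHom).roots.map fun z => τ / (τ - z)).sum -
        ((E.map Complex.ofRealHom).roots.map fun z => τ / (τ - z)).sum‖ < D)
    (hfar : ∀ t : ℝ, 0 < t → A.eval t ≠ 0 → E.eval t ≠ 0 →
      ((((A.map Complex.ofRealHom).roots + (E.map Complex.ofRealHom).roots).filter
        (fun z => δ t * t < ‖(t : ℂ) - z‖)).map (fun z => ‖(t : ℂ) / ((t : ℂ) - z)‖)).sum ≤ (D : ℝ) / 2)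
    (hcover : ∀ t : ℝ, 0 < t → ∀ z ∈ (A.map Complex.ofRealHom).roots + (E.map Complex.ofRealHom).roots,
      ‖(t : ℂ) - z‖ ≤ δ t * t → ∃ i ∈ I, dist (t : ℂ) (ctr i) < rad i) :
    ((A + X ^ D * E).roots.toFinset.filter (fun t => 0 < t)).card ≤
      ∑ i ∈ I, (((A * E).map Complex.ofRealHom).roots.filter fun z => dist z (ctr i) < rad i).toFinset.card +
        (A.roots.toFinset.filter (fun t => 0 < t)).card + 3 * (E.roots.toFinset.filter (fun t => 0 < t)).card + 1 := by
  refine card_posRoots_add_X_pow_mul_le_of_rouche_discs A E D hA hE I ctr rad hrad (fun i hi τ hτ => ?_) (fun t ht hAt hEt hWt => ?_)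
  · obtain ⟨hAτ, hEτ, hsum⟩ := hfield i hi τ hτ
    exact rouche_ineq_of_rootSum_norm_lt A E D hAτ hEτ hsum
  · obtain ⟨z, hz, hclose⟩ := exists_root_near_of_residual_zero_of_farField A E hD hAt hEt hWt (hfar t ht hAt hEt)
    exact hcover t ht z hz hclose

end RootSumDiscs

end Summit.ValiantsHypothesis.ValiantsHypothesis.Theorems.KPlusLogSqLaw.TowerGraft
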